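import Summits.AtomisticToContinuum.HydrodynamicLimit.Theses.GolfBallDice
import HarnessLib

/-!
# Birth skeleton (BC3) for crux `GolfBallDice.ShapeStability` (stmt-AtomisticToContinuum-17627)

Route: `route-AtomisticToContinuum-GolfBallDice` (sub-problem `HydrodynamicLimit`), crux rank 3,
`Summit.AtomisticToContinuum.HydrodynamicLimit.Theses.GolfBallDice.ShapeStability` — for EVERY shape
schedule `Ψ_N` (measurable, odd, positively 1-homogeneous, `(1−a_N)|r| ≤ |Ψ_N r| ≤ (1+a_N)|r|`, angle
defect `≤ s_N`, `a_N, s_N → 0`) there is a packing threshold `η₀ > 0` such that, profile by profile and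
for `σ < σ₀`, along every packing-guarded classical hard-sphere-Euler solution on `[0,T)` and for every
pair (sphere flows `Φ`, shape flows `Φ'`): sphere local-Gibbs LLN at `t = 0` ⇒ for every `t ∈ [0,T)`
WEAK MERGING of the laws of the `χ`-tested density / energy / momentum fields of the two gases
(sphere local Gibbs law `P_N` pushed by `Φ_t`, shape local Gibbs law `P'_N` pushed by `Φ'_t`).

## The cut registered here — STATICS / DYNAMICS (the route header's own foreseen split,
TWO-LAYER PLAN: "ShapeStability ⇐ ShapeStatics (t = 0 …) → ShapeDynamics (t > 0) → ShapeStability")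

* `stub_shapeStatics` — EQUILIBRIUM STATISTICAL MECHANICS, no dynamics, no Euler data, no packing
  guard: for every schedule and all continuous positive profiles, `∃ σ₀ ∀ σ < σ₀`, the two local Gibbs
  FIELD LAWS merge weakly as `N → ∞` — `E_{P_N}[F(field_χ(z))] − E_{P'_N}[F(field_χ(z))] → 0` for every
  continuous `χ`, bounded continuous `F` (density, energy; momentum with `F : ℝ³ → ℝ`), where `P_N`,
  `P'_N` are written FLOW-FREE as `(liouville G (N+1) ε_N).withDensity (canonicalDensity G ε_N (N+1)
  (localGibbsProfile a₀ u₀ θ₀))` for `G = 𝕋³` resp. the `Ψ_N`-geometry (definitionally the crux's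
  `localGibbsLaw …` / `particleLaw (Φ' N) (canonicalDensity (G N) …)`). Content: LLN for the canonical
  local Gibbs law of a gas with the symmetric pair-exclusion body `K_N = {|Ψ_N r| < 1}` (rescaled),
  sandwiched `B(1/(1+a_N)) ⊆ K_N ⊆ B(1/(1−a_N))`, by the low-density cluster expansion UNIFORMLY in the
  body (Kotecký–Preiss / Penrose tree bound uses only `|K_N|`), plus continuity of the Mayer
  coefficients in `|K_N Δ B(1)| → 0`, so both gases' limiting profiles coincide; velocities are
  conditionally Maxwellian in both laws. The sphere half is the tree theorem
  `Literature.MathematicalPhysics.KineticTheory.localGibbs_lln_holds` (geometry `Torus.geometry` only —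
  the `Ψ_N`-geometry version is NOT in tree). Non-vacuity / no junk: for all large `N` (`a_N < 1/2`)
  the shape domain contains the sphere domain at diameter `ε_N/(1−a_N)`, of positive volume for
  `σ < 1/2`, so `canonicalPartition (G N) … > 0` and `P'_N` is a probability law; finitely many small
  `N` (where `Ψ_N` may even vanish and `P'_N = 0`) do not affect `Tendsto … atTop`. Size: L.
* `stub_shapeDynamics` — PROPAGATION OF MERGING ALONG THE TWO DETERMINISTIC EVOLUTIONS (the
  open-problem content, where the route's BoltzmannHypothesis / MacroErgodicity barriers live): the
  crux's own prefix verbatim (`∀` schedule `∃ η₀ ∀` profiles `∃ σ₀ ∀ σ < σ₀ ∀` guarded Euler solution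
  `∀ Φ Φ'`, sphere LLN at `0`), then: IF the two local Gibbs field laws merge at time `0` (flow-free,
  literally `stub_shapeStatics`' conclusion in the crux's `P`/`P'` spelling) THEN they merge at every
  `t ∈ [0,T)` along `Φ_t` resp. `Φ'_t` (the crux's conclusion verbatim). Law-level structural
  stability AT the sphere of fixed-reduced-density hard-particle hydrodynamic statistics under a
  `C^{0,1}`-vanishing perturbation of the collision rule; `t = 0` is contained (`flow 0 = id` a.e.,
  `HardSphereFlow.flow_zero` + `ae_mem_good`). Size: open-problem (hardest stub).

Why this is a cut and not a seam: STATICS is a theorem of equilibrium statistical mechanics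
(partition functions of two exclusion bodies; no flow, no Euler solution, no `η₀`), DYNAMICS is a
statement about two deterministic billiard evolutions that is silent about whether the initial laws
merge; neither implies the other, the crux, or the Statement cheaply (BC3 probes below). The packing
guard and `η₀` sit in the dynamics half only (the Euler clock bounds the window `t < T`); the assembly
takes `η₀` from DYNAMICS and `σ₀ := min σ₀ˢ σ₀ᵈ`.

Assembly `ShapeStability_of : Stubs.stub_shapeStatics → Stubs.stub_shapeDynamics → ShapeStability`
(sorry-free): destructure, merge the two density thresholds, feed STATICS at `σ` (its flow-free
`withDensity` laws are definitionally the crux's `localGibbsLaw` / `particleLaw` lets) into the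
merging-at-0 slot of DYNAMICS. `ShapeStability_of_stubs : ShapeStability` is the hypothesis-free
composition (inherits the two `sorry`s, states nothing new).

File convention (as `Cruxes/ContactChaos/Lines/birth.lean`): each registered stub is a NAMED statement
`def Stubs.stub_<name> : Prop := …` plus the sorried `theorem stub_<name> : <the same text verbatim> := by
sorry`; the assembly takes the stubs BY NAME.

BC3 probes (registrar folder `bc/`, 2026-08-17; each stub as `def S : Prop := …` in a file importing only
the route file + HarnessLib; `set_option maxHeartbeats 400000 in example : S → <target> := by first |
exact? | simpa [S] | (unfold S; simpa) | aesop`): `S → ShapeStability` and `S → _root_.HydrodynamicLimit`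
FAIL for both stubs (rc 1; see `Lines/birth.md` for the per-probe diagnostics).

Disproof used: none exists for this crux (`ledger crux ls stmt-AtomisticToContinuum-17627`: no workfiles
before this line, 2026-08-17). Dead lines: none recorded. Negatives index (`ledger negatives --problem
AtomisticToContinuum`, 20 entries): no refuted statement concerns Gibbs statics across exclusion
geometries or law merging; both stubs keep the crux's schedule hypotheses, local-Gibbs tie and (dynamics)
packing guard verbatim — the untied / unguarded / empty-horizon shapes of stmt-9168, stmt-9395 are not
reintroduced (STATICS has no horizon at all; DYNAMICS quantifies `t ∈ Ico 0 T` exactly as the crux).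
Sources: Spohn1991 Part I Ch. 3; Ruelle1969 §3.4, §4 (cluster expansion, activity series);
OllaVaradhanYau1993 §1; KipnisLandim1999 (weak merging / sandwich); BaladiDemersLiverani2017,
Plakhov2009 (single-billiard shape perturbation — the only printed stability theory).
-/

namespace Summit.AtomisticToContinuum.HydrodynamicLimit.Cruxes.ShapeStability.Birth

open scoped BigOperators Topology Manifold Classical MeasureTheory ProbabilityTheory Matrix InnerProductSpace ComplexConjugate ContinuousMap
open Filter Set Function TopologicalSpace MeasureTheory

/-- stub 1 — SHAPE STATICS (merging of the two local Gibbs FIELD LAWS at time 0; flow-free).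
For every shape schedule `(Ψ, a, s)` and all continuous positive profiles there is `σ₀ > 0` such that
for `0 < σ < σ₀`, with `P_N` the sphere local Gibbs law and `P'_N` the shape-gas local Gibbs law (both
written as `liouville.withDensity (canonicalDensity …)`, flow-free), for every continuous `χ` and
bounded continuous `F`: `∫ F(densityField_χ z) dP_N − ∫ F(densityField_χ z) dP'_N → 0`, likewise for
the energy field and (with `F : ℝ³ → ℝ`) the momentum field. Why plausibly true: low-density cluster
expansion uniform in the (sandwiched) exclusion body + continuity of Mayer coefficients as
`a_N → 0`; the sphere half is `localGibbs_lln_holds`. Size: L. Leans on: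
`Literature.Analysis.FluidPDE.liouville`, `canonicalDensity`, `Torus.geometry`,
`Literature.MathematicalPhysics.KineticTheory.hsDiameter`, `localGibbsProfile`,
`empiricalDensityField/EnergyField/MomentumField`; sources Ruelle1969 §4, Spohn1991 I.3,
LebowitzPenrose1964. -/
def Stubs.stub_shapeStatics : Prop :=
  ∀ (Ψ : ℕ → Literature.MathematicalPhysics.KineticTheory.V3 → Literature.MathematicalPhysics.KineticTheory.V3) (a s : ℕ → ℝ), ((∀ N, Measurable (Ψ N)) ∧ (∀ N r, Ψ N (-r) = -Ψ N r) ∧ (∀ N (c : ℝ) r, 0 < c → Ψ N (c • r) = c • Ψ N r) ∧ (∀ N r, (1 - a N) * ‖r‖ ≤ ‖Ψ N r‖ ∧ ‖Ψ N r‖ ≤ (1 + a N) * ‖r‖) ∧ (∀ N r, ‖(‖r‖) • Ψ N r - (‖Ψ N r‖) • r‖ ≤ s N * (‖r‖ * ‖Ψ N r‖)) ∧ Filter.Tendsto a Filter.atTop (nhds 0) ∧ Filter.Tendsto s Filter.atTop (nhds 0)) → ∀ (a₀ θ₀ : Literature.MathematicalPhysics.KineticTheory.T3 → ℝ) (u₀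 : Literature.MathematicalPhysics.KineticTheory.T3 → Literature.MathematicalPhysics.KineticTheory.V3), Continuous a₀ → Continuous θ₀ → Continuous u₀ → (∀ x, 0 < a₀ x) → (∀ x, 0 < θ₀ x) → ∃ σ₀ : ℝ, 0 < σ₀ ∧ ∀ σ : ℝ, 0 < σ → σ < σ₀ → let G : ℕ → Literature.Analysis.FluidPDE.Geometry (Fin 3) Literature.MathematicalPhysics.KineticTheory.T3 := fun N => (⟨(Literature.Analysis.FluidPDE.Torus.geometry (Fin 3)).translate, fun x y => Ψ N ((Literature.Analysis.FluidPDE.Torus.geometry (Fin 3)).sepVec x y), (Literature.Analysis.FluidPDE.Torus.geometry (Fin 3)).translate_zero, (Literature.Analysis.FluidPDE.Torus.geometry (Fin 3)).translate_add⟩ : Literature.Analysis.FluidPDE.Geometry (Fin 3) Literature.MathematicalPhysics.KineticTheory.T3); let P : (N : ℕ) → MeasureTheory.Measure (Literature.Analysis.FluidPDE.Config (N + 1) (Fin 3) Literature.MathematicalPhysics.KineticTheory.T3) := fun N => (Literature.Analysis.FluidPDE.liouville (Literature.Analysis.FluidPDE.Torus.geometry (Fin 3)) (N + 1) (Literature.MathematicalPhysics.KineticTheory.hsDiameter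 σ N)).withDensity (fun z => ENNReal.ofReal (Literature.Analysis.FluidPDE.canonicalDensity (Literature.Analysis.FluidPDE.Torus.geometry (Fin 3)) (Literature.MathematicalPhysics.KineticTheory.hsDiameter σ N) (N + 1) (Literature.MathematicalPhysics.KineticTheory.localGibbsProfile a₀ u₀ θ₀) z)); let P' : (N : ℕ) → MeasureTheory.Measure (Literature.Analysis.FluidPDE.Config (N + 1) (Fin 3) Literature.MathematicalPhysics.KineticTheory.T3) := fun N => (Literature.Analysis.FluidPDE.liouville (G N) (N + 1) (Literature.MathematicalPhysics.KineticTheory.hsDiameter σ N)).withDensity (fun z => ENNReal.ofReal (Literature.Analysis.FluidPDE.canonicalDensity (G N) (Literature.MathematicalPhysics.KineticTheory.hsDiameter σ N) (N + 1) (Literature.MathematicalPhysics.KineticTheory.localGibbsProfile a₀ u₀ θ₀) z)); ∀ χ : Literature.MathematicalPhysics.KineticTheory.T3 → ℝ, Continuous χ → (∀ Fr : ℝ → ℝ, Continuous Fr → (∃ M : ℝ, ∀ x, |Fr x| ≤ M) → Filter.Tendsto (fun N => (∫ z, Fr (Literature.MathematicalPhysics.KineticTheory.empiricalDensityField z χ)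 ∂(P N)) - ∫ z, Fr (Literature.MathematicalPhysics.KineticTheory.empiricalDensityField z χ) ∂(P' N)) Filter.atTop (nhds 0) ∧ Filter.Tendsto (fun N => (∫ z, Fr (Literature.MathematicalPhysics.KineticTheory.empiricalEnergyField z χ) ∂(P N)) - ∫ z, Fr (Literature.MathematicalPhysics.KineticTheory.empiricalEnergyField z χ) ∂(P' N)) Filter.atTop (nhds 0)) ∧ (∀ Fv : Literature.MathematicalPhysics.KineticTheory.V3 → ℝ, Continuous Fv → (∃ M : ℝ, ∀ v, |Fv v| ≤ M) → Filter.Tendsto (fun N => (∫ z, Fv (Literature.MathematicalPhysics.KineticTheory.empiricalMomentumField z χ) ∂(P N)) - ∫ z, Fv (Literature.MathematicalPhysics.KineticTheory.empiricalMomentumField z χ) ∂(P' N)) Filter.atTop (nhds 0))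

/-- Registered stub 1 (`Stubs.stub_shapeStatics`, verbatim): the `sorry` to be discharged. -/
theorem stub_shapeStatics : ∀ (Ψ : ℕ → Literature.MathematicalPhysics.KineticTheory.V3 → Literature.MathematicalPhysics.KineticTheory.V3) (a s : ℕ → ℝ), ((∀ N, Measurable (Ψ N)) ∧ (∀ N r, Ψ N (-r) = -Ψ N r) ∧ (∀ N (c : ℝ) r, 0 < c → Ψ N (c • r) = c • Ψ N r) ∧ (∀ N r, (1 - a N) * ‖r‖ ≤ ‖Ψ N r‖ ∧ ‖Ψ N r‖ ≤ (1 + a N) * ‖r‖) ∧ (∀ N r, ‖(‖r‖) • Ψ N r - (‖Ψ N r‖) • r‖ ≤ s N * (‖r‖ * ‖Ψ N r‖)) ∧ Filter.Tendsto a Filter.atTop (nhds 0) ∧ Filter.Tendsto s Filter.atTop (nhds 0)) → ∀ (a₀ θ₀ : Literature.MathematicalPhysics.KineticTheory.T3 → ℝ) (u₀ : Literature.MathematicalPhysics.KineticTheory.T3 → Literature.MathematicalPhysics.KineticTheory.V3), Continuous a₀ → Continuous θ₀ → Continuous u₀ → (∀ x, 0 < a₀ x) → (∀ x, 0 < θ₀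 x) → ∃ σ₀ : ℝ, 0 < σ₀ ∧ ∀ σ : ℝ, 0 < σ → σ < σ₀ → let G : ℕ → Literature.Analysis.FluidPDE.Geometry (Fin 3) Literature.MathematicalPhysics.KineticTheory.T3 := fun N => (⟨(Literature.Analysis.FluidPDE.Torus.geometry (Fin 3)).translate, fun x y => Ψ N ((Literature.Analysis.FluidPDE.Torus.geometry (Fin 3)).sepVec x y), (Literature.Analysis.FluidPDE.Torus.geometry (Fin 3)).translate_zero, (Literature.Analysis.FluidPDE.Torus.geometry (Fin 3)).translate_add⟩ : Literature.Analysis.FluidPDE.Geometry (Fin 3) Literature.MathematicalPhysics.KineticTheory.T3); let P : (N : ℕ) → MeasureTheory.Measure (Literature.Analysis.FluidPDE.Config (N + 1) (Fin 3) Literature.MathematicalPhysics.KineticTheory.T3) := fun N => (Literature.Analysis.FluidPDE.liouville (Literature.Analysis.FluidPDE.Torus.geometry (Fin 3)) (N + 1) (Literature.MathematicalPhysics.KineticTheory.hsDiameter σ N)).withDensity (fun z => ENNReal.ofReal (Literature.Analysis.FluidPDE.canonicalDensity (Literature.Analysis.FluidPDE.Torus.geometry (Fin 3)) (Literature.MathematicalPhysics.KineticTheory.hsDiameter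 σ N) (N + 1) (Literature.MathematicalPhysics.KineticTheory.localGibbsProfile a₀ u₀ θ₀) z)); let P' : (N : ℕ) → MeasureTheory.Measure (Literature.Analysis.FluidPDE.Config (N + 1) (Fin 3) Literature.MathematicalPhysics.KineticTheory.T3) := fun N => (Literature.Analysis.FluidPDE.liouville (G N) (N + 1) (Literature.MathematicalPhysics.KineticTheory.hsDiameter σ N)).withDensity (fun z => ENNReal.ofReal (Literature.Analysis.FluidPDE.canonicalDensity (G N) (Literature.MathematicalPhysics.KineticTheory.hsDiameter σ N) (N + 1) (Literature.MathematicalPhysics.KineticTheory.localGibbsProfile a₀ u₀ θ₀) z)); ∀ χ : Literature.MathematicalPhysics.KineticTheory.T3 → ℝ, Continuous χ → (∀ Fr : ℝ → ℝ, Continuous Fr → (∃ M : ℝ, ∀ x, |Fr x| ≤ M) → Filter.Tendsto (fun N => (∫ z, Fr (Literature.MathematicalPhysics.KineticTheory.empiricalDensityField z χ) ∂(P N)) - ∫ z, Fr (Literature.MathematicalPhysics.KineticTheory.empiricalDensityField z χ) ∂(P' N)) Filter.atTop (nhds 0) ∧ Filter.Tendsto (fun N => (∫ z, Fr (Literature.MathematicalPhysics.KineticTheory.empiricalEnergyField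 z χ) ∂(P N)) - ∫ z, Fr (Literature.MathematicalPhysics.KineticTheory.empiricalEnergyField z χ) ∂(P' N)) Filter.atTop (nhds 0)) ∧ (∀ Fv : Literature.MathematicalPhysics.KineticTheory.V3 → ℝ, Continuous Fv → (∃ M : ℝ, ∀ v, |Fv v| ≤ M) → Filter.Tendsto (fun N => (∫ z, Fv (Literature.MathematicalPhysics.KineticTheory.empiricalMomentumField z χ) ∂(P N)) - ∫ z, Fv (Literature.MathematicalPhysics.KineticTheory.empiricalMomentumField z χ) ∂(P' N)) Filter.atTop (nhds 0)) := by
  sorry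

/-- stub 2 — SHAPE DYNAMICS (propagation of merging along the two deterministic evolutions; the
open-problem content). The crux's prefix verbatim — `∀` schedule, `∃ η₀ > 0`, `∀` profiles, `∃ σ₀`,
`∀ σ ∈ (0,σ₀)`, `∀` classical hard-sphere-Euler solution on `[0,T)` with the packing guard
`ρ_t(x)σ³ < η₀`, `∀` sphere flows `Φ` and shape flows `Φ'`, sphere local-Gibbs LLN at `t = 0` — then:
IF the two local Gibbs field laws merge at time `0` (flow-free: `stub_shapeStatics`' conclusion in the
crux's `P := localGibbsLaw …`, `P' := particleLaw (Φ' N) (canonicalDensity (G N) …)` spelling) THEN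
for every `t ∈ [0,T)`, continuous `χ`, bounded continuous `F` the laws of the `χ`-tested density /
energy / momentum fields of `Φ_t z` under `P_N` and of `Φ'_t z` under `P'_N` merge (the crux's
conclusion verbatim). Why it might fail: exactly the crux's risk (trajectories decorrelate after one
mean free time; no law-level structural-stability theory for N-body billiards exists; false iff
smooth spheres keep non-hydrodynamic slow structure in the dilute band that every vanishing roughness
destroys). Size: open-problem (hardest stub). Leans on: `HardSphereFlow`, `localGibbsLaw`,
`particleLaw`, `canonicalDensity`, `IsHardSphereEulerSolution`, `TendstoHydroFieldsAt`; sources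
OllaVaradhanYau1993, Spohn1991, BaladiDemersLiverani2017, Plakhov2009, Simanyi2013. -/
def Stubs.stub_shapeDynamics : Prop :=
  ∀ (Ψ : ℕ → Literature.MathematicalPhysics.KineticTheory.V3 → Literature.MathematicalPhysics.KineticTheory.V3) (a s : ℕ → ℝ), ((∀ N, Measurable (Ψ N)) ∧ (∀ N r, Ψ N (-r) = -Ψ N r) ∧ (∀ N (c : ℝ) r, 0 < c → Ψ N (c • r) = c • Ψ N r) ∧ (∀ N r, (1 - a N) * ‖r‖ ≤ ‖Ψ N r‖ ∧ ‖Ψ N r‖ ≤ (1 + a N) * ‖r‖) ∧ (∀ N r, ‖(‖r‖) • Ψ N r - (‖Ψ N r‖) • r‖ ≤ s N * (‖r‖ * ‖Ψ N r‖)) ∧ Filter.Tendsto a Filter.atTop (nhds 0) ∧ Filter.Tendsto s Filter.atTop (nhds 0)) → ∃ η₀ : ℝ, 0 < η₀ ∧ ∀ (a₀ θ₀ : Literature.MathematicalPhysics.KineticTheory.T3 → ℝ) (u₀ : Literature.MathematicalPhysics.KineticTheory.T3 → Literature.MathematicalPhysics.KineticTheory.V3), Continuous a₀ → Continuous θ₀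 → Continuous u₀ → (∀ x, 0 < a₀ x) → (∀ x, 0 < θ₀ x) → ∃ σ₀ : ℝ, 0 < σ₀ ∧ ∀ σ : ℝ, 0 < σ → σ < σ₀ → ∀ (T : ℝ) (ρ θ : ℝ → Literature.MathematicalPhysics.KineticTheory.T3 → ℝ) (u : ℝ → Literature.MathematicalPhysics.KineticTheory.T3 → Literature.MathematicalPhysics.KineticTheory.V3), Literature.MathematicalPhysics.KineticTheory.IsHardSphereEulerSolution σ T ρ u θ → (∀ t ∈ Set.Ico 0 T, ∀ x, ρ t x * σ ^ 3 < η₀) → ∀ Φ : (N : ℕ) → Literature.Analysis.FluidPDE.HardSphereFlow (Literature.Analysis.FluidPDE.Torus.geometry (Fin 3)) (Literature.MathematicalPhysics.KineticTheory.hsDiameter σ N) (N + 1), let G : ℕ → Literature.Analysis.FluidPDE.Geometry (Fin 3) Literature.MathematicalPhysics.KineticTheory.T3 := fun N => (⟨(Literature.Analysis.FluidPDE.Torus.geometry (Fin 3)).translate, fun x y => Ψ N ((Literature.Analysis.FluidPDE.Torus.geometry (Fin 3)).sepVec x y), (Literature.Analysis.FluidPDE.Torus.geometry (Fin 3)).translate_zero,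 (Literature.Analysis.FluidPDE.Torus.geometry (Fin 3)).translate_add⟩ : Literature.Analysis.FluidPDE.Geometry (Fin 3) Literature.MathematicalPhysics.KineticTheory.T3); ∀ Φ' : (N : ℕ) → Literature.Analysis.FluidPDE.HardSphereFlow (G N) (Literature.MathematicalPhysics.KineticTheory.hsDiameter σ N) (N + 1), Literature.MathematicalPhysics.KineticTheory.TendstoHydroFieldsAt (fun N => Literature.MathematicalPhysics.KineticTheory.localGibbsLaw σ a₀ u₀ θ₀ N (Φ N)) Φ ρ u θ 0 → let P : (N : ℕ) → MeasureTheory.Measure (Literature.Analysis.FluidPDE.Config (N + 1) (Fin 3) Literature.MathematicalPhysics.KineticTheory.T3) := fun N => Literature.MathematicalPhysics.KineticTheory.localGibbsLaw σ a₀ u₀ θ₀ N (Φ N); let P' : (N : ℕ) → MeasureTheory.Measure (Literature.Analysis.FluidPDE.Config (N + 1) (Fin 3) Literature.MathematicalPhysics.KineticTheory.T3) := fun N => Literature.Analysis.FluidPDE.particleLaw (Φ' N) (Literature.Analysis.FluidPDE.canonicalDensity (G N) (Literature.MathematicalPhysics.KineticTheory.hsDiameter σ N) (N + 1) (Literature.MathematicalPhysics.KineticTheory.localGibbsProfile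 a₀ u₀ θ₀)); (∀ χ : Literature.MathematicalPhysics.KineticTheory.T3 → ℝ, Continuous χ → (∀ Fr : ℝ → ℝ, Continuous Fr → (∃ M : ℝ, ∀ x, |Fr x| ≤ M) → Filter.Tendsto (fun N => (∫ z, Fr (Literature.MathematicalPhysics.KineticTheory.empiricalDensityField z χ) ∂(P N)) - ∫ z, Fr (Literature.MathematicalPhysics.KineticTheory.empiricalDensityField z χ) ∂(P' N)) Filter.atTop (nhds 0) ∧ Filter.Tendsto (fun N => (∫ z, Fr (Literature.MathematicalPhysics.KineticTheory.empiricalEnergyField z χ) ∂(P N)) - ∫ z, Fr (Literature.MathematicalPhysics.KineticTheory.empiricalEnergyField z χ) ∂(P' N)) Filter.atTop (nhds 0)) ∧ (∀ Fv : Literature.MathematicalPhysics.KineticTheory.V3 → ℝ, Continuous Fv → (∃ M : ℝ, ∀ v, |Fv v| ≤ M) → Filter.Tendsto (fun N => (∫ z, Fv (Literature.MathematicalPhysics.KineticTheory.empiricalMomentumField z χ) ∂(P N)) - ∫ z, Fv (Literature.MathematicalPhysics.KineticTheory.empiricalMomentumField z χ) ∂(P' N)) Filter.atTop (nhds 0)))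 → ∀ t ∈ Set.Ico 0 T, ∀ χ : Literature.MathematicalPhysics.KineticTheory.T3 → ℝ, Continuous χ → (∀ Fr : ℝ → ℝ, Continuous Fr → (∃ M : ℝ, ∀ x, |Fr x| ≤ M) → Filter.Tendsto (fun N => (∫ z, Fr (Literature.MathematicalPhysics.KineticTheory.empiricalDensityField ((Φ N).flow t z) χ) ∂(P N)) - ∫ z, Fr (Literature.MathematicalPhysics.KineticTheory.empiricalDensityField ((Φ' N).flow t z) χ) ∂(P' N)) Filter.atTop (nhds 0) ∧ Filter.Tendsto (fun N => (∫ z, Fr (Literature.MathematicalPhysics.KineticTheory.empiricalEnergyField ((Φ N).flow t z) χ) ∂(P N)) - ∫ z, Fr (Literature.MathematicalPhysics.KineticTheory.empiricalEnergyField ((Φ' N).flow t z) χ) ∂(P' N)) Filter.atTop (nhds 0)) ∧ (∀ Fv : Literature.MathematicalPhysics.KineticTheory.V3 → ℝ, Continuous Fv → (∃ M : ℝ, ∀ v, |Fv v| ≤ M) → Filter.Tendsto (fun N => (∫ z, Fv (Literature.MathematicalPhysics.KineticTheory.empiricalMomentumField ((Φ N).flow t z) χ) ∂(P N)) - ∫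 z, Fv (Literature.MathematicalPhysics.KineticTheory.empiricalMomentumField ((Φ' N).flow t z) χ) ∂(P' N)) Filter.atTop (nhds 0))

/-- Registered stub 2 (`Stubs.stub_shapeDynamics`, verbatim): the `sorry` to be discharged. -/
theorem stub_shapeDynamics : ∀ (Ψ : ℕ → Literature.MathematicalPhysics.KineticTheory.V3 → Literature.MathematicalPhysics.KineticTheory.V3) (a s : ℕ → ℝ), ((∀ N, Measurable (Ψ N)) ∧ (∀ N r, Ψ N (-r) = -Ψ N r) ∧ (∀ N (c : ℝ) r, 0 < c → Ψ N (c • r) = c • Ψ N r) ∧ (∀ N r, (1 - a N) * ‖r‖ ≤ ‖Ψ N r‖ ∧ ‖Ψ N r‖ ≤ (1 + a N) * ‖r‖) ∧ (∀ N r, ‖(‖r‖) • Ψ N r - (‖Ψ N r‖) • r‖ ≤ s N * (‖r‖ * ‖Ψ N r‖)) ∧ Filter.Tendsto a Filter.atTop (nhds 0) ∧ Filter.Tendsto s Filter.atTop (nhds 0)) → ∃ η₀ : ℝ, 0 < η₀ ∧ ∀ (a₀ θ₀ : Literature.MathematicalPhysics.KineticTheory.T3 → ℝ) (u₀ : Literature.MathematicalPhysics.KineticTheory.T3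 → Literature.MathematicalPhysics.KineticTheory.V3), Continuous a₀ → Continuous θ₀ → Continuous u₀ → (∀ x, 0 < a₀ x) → (∀ x, 0 < θ₀ x) → ∃ σ₀ : ℝ, 0 < σ₀ ∧ ∀ σ : ℝ, 0 < σ → σ < σ₀ → ∀ (T : ℝ) (ρ θ : ℝ → Literature.MathematicalPhysics.KineticTheory.T3 → ℝ) (u : ℝ → Literature.MathematicalPhysics.KineticTheory.T3 → Literature.MathematicalPhysics.KineticTheory.V3), Literature.MathematicalPhysics.KineticTheory.IsHardSphereEulerSolution σ T ρ u θ → (∀ t ∈ Set.Ico 0 T, ∀ x, ρ t x * σ ^ 3 < η₀) → ∀ Φ : (N : ℕ) → Literature.Analysis.FluidPDE.HardSphereFlow (Literature.Analysis.FluidPDE.Torus.geometry (Fin 3)) (Literature.MathematicalPhysics.KineticTheory.hsDiameter σ N) (N + 1), let G : ℕ → Literature.Analysis.FluidPDE.Geometry (Fin 3) Literature.MathematicalPhysics.KineticTheory.T3 := fun N => (⟨(Literature.Analysis.FluidPDE.Torus.geometry (Fin 3)).translate, fun x y => Ψ N ((Literature.Analysis.FluidPDE.Torus.geometry (Fin 3)).sepVec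 x y), (Literature.Analysis.FluidPDE.Torus.geometry (Fin 3)).translate_zero, (Literature.Analysis.FluidPDE.Torus.geometry (Fin 3)).translate_add⟩ : Literature.Analysis.FluidPDE.Geometry (Fin 3) Literature.MathematicalPhysics.KineticTheory.T3); ∀ Φ' : (N : ℕ) → Literature.Analysis.FluidPDE.HardSphereFlow (G N) (Literature.MathematicalPhysics.KineticTheory.hsDiameter σ N) (N + 1), Literature.MathematicalPhysics.KineticTheory.TendstoHydroFieldsAt (fun N => Literature.MathematicalPhysics.KineticTheory.localGibbsLaw σ a₀ u₀ θ₀ N (Φ N)) Φ ρ u θ 0 → let P : (N : ℕ) → MeasureTheory.Measure (Literature.Analysis.FluidPDE.Config (N + 1) (Fin 3) Literature.MathematicalPhysics.KineticTheory.T3) := fun N => Literature.MathematicalPhysics.KineticTheory.localGibbsLaw σ a₀ u₀ θ₀ N (Φ N); let P' : (N : ℕ) → MeasureTheory.Measure (Literature.Analysis.FluidPDE.Config (N + 1) (Fin 3) Literature.MathematicalPhysics.KineticTheory.T3) := fun N => Literature.Analysis.FluidPDE.particleLaw (Φ' N) (Literature.Analysis.FluidPDE.canonicalDensity (G N) (Literature.MathematicalPhysics.KineticTheory.hsDiameter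 σ N) (N + 1) (Literature.MathematicalPhysics.KineticTheory.localGibbsProfile a₀ u₀ θ₀)); (∀ χ : Literature.MathematicalPhysics.KineticTheory.T3 → ℝ, Continuous χ → (∀ Fr : ℝ → ℝ, Continuous Fr → (∃ M : ℝ, ∀ x, |Fr x| ≤ M) → Filter.Tendsto (fun N => (∫ z, Fr (Literature.MathematicalPhysics.KineticTheory.empiricalDensityField z χ) ∂(P N)) - ∫ z, Fr (Literature.MathematicalPhysics.KineticTheory.empiricalDensityField z χ) ∂(P' N)) Filter.atTop (nhds 0) ∧ Filter.Tendsto (fun N => (∫ z, Fr (Literature.MathematicalPhysics.KineticTheory.empiricalEnergyField z χ) ∂(P N)) - ∫ z, Fr (Literature.MathematicalPhysics.KineticTheory.empiricalEnergyField z χ) ∂(P' N)) Filter.atTop (nhds 0)) ∧ (∀ Fv : Literature.MathematicalPhysics.KineticTheory.V3 → ℝ, Continuous Fv → (∃ M : ℝ, ∀ v, |Fv v| ≤ M) → Filter.Tendsto (fun N => (∫ z, Fv (Literature.MathematicalPhysics.KineticTheory.empiricalMomentumField z χ) ∂(P N)) - ∫ z, Fv (Literature.MathematicalPhysics.KineticTheory.empiricalMomentumField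 z χ) ∂(P' N)) Filter.atTop (nhds 0))) → ∀ t ∈ Set.Ico 0 T, ∀ χ : Literature.MathematicalPhysics.KineticTheory.T3 → ℝ, Continuous χ → (∀ Fr : ℝ → ℝ, Continuous Fr → (∃ M : ℝ, ∀ x, |Fr x| ≤ M) → Filter.Tendsto (fun N => (∫ z, Fr (Literature.MathematicalPhysics.KineticTheory.empiricalDensityField ((Φ N).flow t z) χ) ∂(P N)) - ∫ z, Fr (Literature.MathematicalPhysics.KineticTheory.empiricalDensityField ((Φ' N).flow t z) χ) ∂(P' N)) Filter.atTop (nhds 0) ∧ Filter.Tendsto (fun N => (∫ z, Fr (Literature.MathematicalPhysics.KineticTheory.empiricalEnergyField ((Φ N).flow t z) χ) ∂(P N)) - ∫ z, Fr (Literature.MathematicalPhysics.KineticTheory.empiricalEnergyField ((Φ' N).flow t z) χ) ∂(P' N)) Filter.atTop (nhds 0)) ∧ (∀ Fv : Literature.MathematicalPhysics.KineticTheory.V3 → ℝ, Continuous Fv → (∃ M : ℝ, ∀ v, |Fv v| ≤ M) → Filter.Tendsto (fun N => (∫ z, Fv (Literature.MathematicalPhysics.KineticTheory.empiricalMomentumField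 ((Φ N).flow t z) χ) ∂(P N)) - ∫ z, Fv (Literature.MathematicalPhysics.KineticTheory.empiricalMomentumField ((Φ' N).flow t z) χ) ∂(P' N)) Filter.atTop (nhds 0)) := by
  sorry

/-- ASSEMBLY (kernel-checked, no `sorry`): STATICS and DYNAMICS, taken BY NAME (`Stubs.*`), give the
crux BY NAME. `η₀` from DYNAMICS; `σ₀ := min σ₀ˢ σ₀ᵈ`; STATICS at `σ` (flow-free `withDensity` laws,
definitionally the crux's `localGibbsLaw` / `particleLaw` lets) fills the merging-at-0 slot. -/
theorem ShapeStability_of : Stubs.stub_shapeStatics → Stubs.stub_shapeDynamics → Summit.AtomisticToContinuum.HydrodynamicLimit.Theses.GolfBallDice.ShapeStability := by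
  intro hS hD Ψ a s hΨ
  obtain ⟨η₀, hη₀, H⟩ := hD Ψ a s hΨ
  refine ⟨η₀, hη₀, fun a₀ θ₀ u₀ ha hθ hu ha0 hθ0 => ?_⟩
  obtain ⟨σ₁, hσ₁, H₁⟩ := hS Ψ a s hΨ a₀ θ₀ u₀ ha hθ hu ha0 hθ0
  obtain ⟨σ₂, hσ₂, H₂⟩ := H a₀ θ₀ u₀ ha hθ hu ha0 hθ0
  refine ⟨min σ₁ σ₂, lt_min hσ₁ hσ₂, ?_⟩
  intro σ hσ hσlt T ρ θ u hsol hgd Φ G Φ' h0 P P' t ht χ hχ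
  have hlt₁ : σ < σ₁ := hσlt.trans_le (min_le_left _ _)
  have hlt₂ : σ < σ₂ := hσlt.trans_le (min_le_right _ _)
  have hstat := H₁ σ hσ hlt₁
  exact H₂ σ hσ hlt₂ T ρ θ u hsol hgd Φ Φ' h0 hstat t ht χ hχ

/-- The crux from the two registered stubs (hypothesis-free composition; type-checks that the verbatim
stub statements are definitionally the named `Stubs.*` hypotheses of `ShapeStability_of`; inherits the
stubs' `sorry`s, states nothing new). -/
theorem ShapeStability_of_stubs : Summit.AtomisticToContinuum.HydrodynamicLimit.Theses.GolfBallDice.ShapeStability :=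
  ShapeStability_of stub_shapeStatics stub_shapeDynamics

end Summit.AtomisticToContinuum.HydrodynamicLimit.Cruxes.ShapeStability.Birth
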